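import Mathlib
import HarnessLib
import Summits.Ventures.LatticeQCDFlow.Exactness.GaugeFTHMCReversible
import Summits.Ventures.LatticeQCDFlow.Exactness.OpenBoundaryHMCForce
import Summits.Ventures.LatticeQCDFlow.Exactness.OpenBoundaryTranslation
import Summits.Ventures.LatticeQCDFlow.Scoring.ReversibleKernelTauIntFloor

/-!
# Row 21's HMC arms satisfy DETAILED BALANCE: the engine's `n`-step leapfrog HMC on `SU(N)` is reversible for `e^{−S}·Haar^⊗` — the periodic arm for the Wilson measure, the open-boundary arm for the open-boundary Gibbs law; hence the reversible-chain `τ_int` floors apply to both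

HONEST FRAMING: exact (Metropolis-corrected) sampling algorithms for lattice gauge theory;
figures of merit are autocorrelation/cost numbers at stated couplings and volumes; no
continuum-physics claim.

Venture `LatticeQCDFlow` (cell pub-lqcd), topic `Exactness`, FANOUT row 21 (`su3-base`, arms `E2 = PBC-HMC` and `OBC-HMC` AS RUN:
row 9's `sunLeapfrogHMCN` with row 21's forces).  NEW WORK of the cell: the `SU(N)` members that row 14's `GaugeFTHMCReversible`
lists as "NOT here" (`hmc_config_isReversible`: refresh → volume-preserving involutive proposal → Metropolis → forget is
`e^{−S}·vol`-REVERSIBLE), for row 9's `n`-step proposal (`involutive_sunLeapfrogProposalN`, `measurePreserving_sunLeapfrogProposalN`);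
then row 8's `Scoring/ReversibleKernelTauIntFloor` (even lags are squares, pair positivity, odd windows below `τ_int`, Madras–Slade's
`(1 + ρ₁)/(2(1 − ρ₁)) ≤ τ_int` for EVERY reversible kernel) read for the two arms.  Def-free; nothing is cited as a fact; no number.

* §1 **`sunLeapfrogHMCN_isReversible`** — for every measurable action `S`, measurable increment `g`, kinetic energy `T`, step
  `ε`, `n`: `IsReversible (sunLeapfrogHMCN ι hι ε μ T hg S n) (Haar^⊗.withDensity e^{−S})`; `…_isReversible_gibbsProbability`
  (the normalised law).
* §2 **`wilsonForce_sunLeapfrogHMCN_isReversible`** — the PERIODIC ARM as run (own Wilson force, Metropolis on `βS_W`) is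
  reversible for `wilsonMeasure (suRep N) β`, every `β`, `ε`, `nstep`, `L`; **`obcForce_sunLeapfrogHMCN_isReversible`** — the
  OPEN-BOUNDARY ARM as run is reversible for the open-boundary Gibbs law, every `τ`.
* §3 `isMarkovKernel_sunLeapfrogHMCN_sunKinetic` (the engine kernel with the engine's kinetic energy is Markov); consequences in
  equilibrium (stationary start), for every bounded measurable observable `g` (plaquette, `cos`-bins of the
  charge, indicator of a topological sector, …) and both arms: **`wilsonHmc_autocov_even_nonneg`** (`C_g(2m) ≥ 0`),
  `wilsonHmc_autocov_pair_nonneg` (`C_g(2m) + C_g(2m+1) ≥ 0`), **`wilsonHmc_tauInt_ge`** (Madras–Slade floor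
  `(1 + ρ₁)/(2(1 − ρ₁)) ≤ τ_int(g)` under summability and `ρ₁ < 1`), and the open-boundary twins.
NOT CLAIMED: reversibility of arm E1 (the heat-bath + overrelaxation composite in a fixed order is NOT reversible; only its factors
are); any value of `ρ₁` or `τ_int`; numbers.
-/

noncomputable section

namespace Summit.Ventures.LatticeQCDFlow.Exactness

open MeasureTheory ProbabilityTheory ProbabilityTheory.Kernel Set Function
open Literature.MathematicalPhysics.QuantumFieldTheory
open scoped ENNReal Matrix

set_option backward.isDefEq.respectTransparency false

/-! ## §1 The engine kernel is reversible for `e^{−S}·Haar^⊗` -/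

section General

variable {n : Type*} [Fintype n] [DecidableEq n]
variable {E : Type*} [NormedAddCommGroup E] [NormedSpace ℝ E] [MeasurableSpace E] [BorelSpace E] [FiniteDimensional ℝ E]
variable (ι : E →ₗ[ℝ] Matrix n n ℂ) (hι : ∀ a, (ι a)ᴴ = -ι a ∧ (ι a).trace = 0)
variable {Lk : Type*} [Fintype Lk] (ε : ℝ) (μ : Measure E) [μ.IsAddHaarMeasure] {T : (Lk → E) → ℝ}
variable {g : (Lk → Matrix.specialUnitaryGroup n ℂ) → Lk → E} (hg : Measurable g)

/-- **DETAILED BALANCE OF THE ENGINE'S `n`-STEP LEAPFROG HMC**: for every measurable action `S`, kinetic energy `T`, increment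
`g`, step `ε` and `n`, the configuration kernel is reversible for `e^{−S}·Haar^{⊗links}`. -/
theorem sunLeapfrogHMCN_isReversible (hT : Measurable T) {S : (Lk → Matrix.specialUnitaryGroup n ℂ) → ℝ} (hS : Measurable S)
    (N : ℕ) :
    IsReversible (sunLeapfrogHMCN ι hι ε μ T hg S N)
      ((Measure.pi fun _ : Lk => haarProbability (Matrix.specialUnitaryGroup n ℂ)).withDensity
        fun u => ENNReal.ofReal (Real.exp (-S u))) :=
  hmc_config_isReversible (vol := Measure.pi fun _ : Lk => haarProbability (Matrix.specialUnitaryGroup n ℂ))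
    (volP := Measure.pi fun _ : Lk => μ) (hΦ := measurable_sunLeapfrogProposalN ι hι ε N hg) hS hT
    (involutive_sunLeapfrogProposalN ι hι ε g N) (measurePreserving_sunLeapfrogProposalN ι hι ε N μ hg)

/-- The same for the normalised Gibbs law `Z⁻¹ e^{−S}·Haar^{⊗links}`. -/
theorem sunLeapfrogHMCN_isReversible_gibbsProbability (hT : Measurable T)
    {S : (Lk → Matrix.specialUnitaryGroup n ℂ) → ℝ} (hS : Measurable S) (N : ℕ) :
    IsReversible (sunLeapfrogHMCN ι hι ε μ T hg S N)
      (gibbsProbability (Measure.pi fun _ : Lk => haarProbability (Matrix.specialUnitaryGroup n ℂ)) fun u => Real.exp (-S u)) :=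
  isReversible_smul (sunLeapfrogHMCN_isReversible ι hι ε μ hg hT hS N) _

end General

/-! ## §2 The two arms as run -/

section Arms

variable (N : ℕ) {d L : ℕ} [NeZero L]

/-- **THE PERIODIC HMC ARM AS RUN IS REVERSIBLE FOR THE WILSON MEASURE** (every `β`, `ε`, `nstep`, `L`). -/
theorem wilsonForce_sunLeapfrogHMCN_isReversible (β ε : ℝ) (nstep : ℕ) :
    IsReversible (sunLeapfrogHMCN (sunCoordι N) (sunCoordι_skew N) ε (Measure.addHaar : Measure (SUNCoords N)) (sunKinetic N)
        (measurable_halfKick_sun N (measurable_sunWilsonForce N (d := d) (L := L) β) ε)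
        (fun U => β * wilsonAction (suRep N) U) nstep)
      (wilsonMeasure (d := d) (L := L) (suRep N) β) := by
  rw [← gibbsProbability_smul_wilsonAction_eq N (d := d) (L := L) (suRep N) β]
  exact sunLeapfrogHMCN_isReversible_gibbsProbability (sunCoordι N) (sunCoordι_skew N) ε Measure.addHaar
    (measurable_halfKick_sun N (measurable_sunWilsonForce N (d := d) (L := L) β) ε) (measurable_sunKinetic N)
    ((continuous_smul_wilsonAction (suRep N) continuous_suRep β).measurable) nstep

/-- **THE OPEN-BOUNDARY HMC ARM AS RUN IS REVERSIBLE FOR THE OPEN-BOUNDARY GIBBS LAW** (every `τ`, `β`, `ε`, `nstep`, `L`). -/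
theorem obcForce_sunLeapfrogHMCN_isReversible (τ : Fin d) (β ε : ℝ) (nstep : ℕ) :
    IsReversible (sunLeapfrogHMCN (sunCoordι N) (sunCoordι_skew N) ε (Measure.addHaar : Measure (SUNCoords N)) (sunKinetic N)
        (measurable_halfKick_sun N (measurable_sunWeightedForce N (d := d) (L := L) (obcWeight τ) β) ε)
        (fun U => β * obcAction (suRep N) τ U) nstep)
      (gibbsProbability (Measure.pi fun _ : Edge d L => haarProbability (Matrix.specialUnitaryGroup (Fin N) ℂ))
        fun U => Real.exp (-(β * obcAction (suRep N) τ U))) :=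
  sunLeapfrogHMCN_isReversible_gibbsProbability (sunCoordι N) (sunCoordι_skew N) ε Measure.addHaar
    (measurable_halfKick_sun N (measurable_sunWeightedForce N (d := d) (L := L) (obcWeight τ) β) ε) (measurable_sunKinetic N)
    ((continuous_obcAction (suRep N) continuous_suRep τ).measurable.const_mul β) nstep

end Arms

/-! ## §3 Consequences in equilibrium: even lags are squares, pair positivity, the Madras–Slade floor -/

section Floors

variable (N : ℕ) {d L : ℕ} [NeZero L]

/-- **The engine kernel with the engine's kinetic energy is Markov** (every link type, measurable action, measurable increment,
`ε`, `n`): the `t`-step laws from probability starts are probability laws. -/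
theorem isMarkovKernel_sunLeapfrogHMCN_sunKinetic {Lk : Type*} [Fintype Lk] (ε : ℝ)
    {g : (Lk → Matrix.specialUnitaryGroup (Fin N) ℂ) → Lk → SUNCoords N} (hg : Measurable g)
    {S : (Lk → Matrix.specialUnitaryGroup (Fin N) ℂ) → ℝ} (hS : Measurable S) (n : ℕ) :
    IsMarkovKernel (sunLeapfrogHMCN (sunCoordι N) (sunCoordι_skew N) ε (Measure.addHaar : Measure (SUNCoords N)) (sunKinetic N)
      hg S n) := by
  haveI : Fact (Measurable fun z : (Lk → Matrix.specialUnitaryGroup (Fin N) ℂ) × (Lk → SUNCoords N) => S z.1 + sunKinetic N z.2) :=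
    ⟨(hS.comp measurable_fst).add ((measurable_sunKinetic N).comp measurable_snd)⟩
  haveI := isProbabilityMeasure_sunMomentumLaw (L := Lk) (Measure.addHaar : Measure (SUNCoords N)) (sunKinetic N)
    (measurable_sunKinetic N) (sunMomentumWeight_sunKinetic_ne_top N Measure.addHaar)
  unfold sunLeapfrogHMCN
  infer_instance

/-- **Even-lag autocovariances of the periodic arm in equilibrium are nonnegative**: `C_g(2m) ≥ 0` for every bounded measurable
`g` (they are squares of `m`-step conditional expectations). -/
theorem wilsonHmc_autocov_even_nonneg [NeZero N] (β ε : ℝ) (nstep : ℕ) {g : GaugeConfig d L (Matrix.specialUnitaryGroup (Fin N) ℂ) → ℝ}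
    (hg : Measurable g) {B : ℝ} (hB : ∀ U, |g U| ≤ B) (m : ℕ) :
    0 ≤ Scoring.autocov (sunLeapfrogHMCN (sunCoordι N) (sunCoordι_skew N) ε (Measure.addHaar : Measure (SUNCoords N)) (sunKinetic N)
        (measurable_halfKick_sun N (measurable_sunWilsonForce N (d := d) (L := L) β) ε)
        (fun U => β * wilsonAction (suRep N) U) nstep) (wilsonMeasure (d := d) (L := L) (suRep N) β) g (2 * m) := by
  haveI := isMarkovKernel_sunLeapfrogHMCN_sunKinetic N (Lk := Edge d L) ε
    (measurable_halfKick_sun N (measurable_sunWilsonForce N (d := d) (L := L) β) ε)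
    ((continuous_smul_wilsonAction (suRep N) continuous_suRep β).measurable) nstep
  haveI := isProbabilityMeasure_wilsonMeasure (d := d) (L := L) (suRep N) continuous_suRep β
  exact Scoring.autocov_even_nonneg_of_isReversible (wilsonForce_sunLeapfrogHMCN_isReversible N β ε nstep) hg hB m

/-- **Pair positivity for the periodic arm**: `C_g(2m) + C_g(2m+1) ≥ 0`. -/
theorem wilsonHmc_autocov_pair_nonneg [NeZero N] (β ε : ℝ) (nstep : ℕ) {g : GaugeConfig d L (Matrix.specialUnitaryGroup (Fin N) ℂ) → ℝ}
    (hg : Measurable g) {B : ℝ} (hB : ∀ U, |g U| ≤ B) (m : ℕ) :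
    0 ≤ Scoring.autocov (sunLeapfrogHMCN (sunCoordι N) (sunCoordι_skew N) ε (Measure.addHaar : Measure (SUNCoords N)) (sunKinetic N)
          (measurable_halfKick_sun N (measurable_sunWilsonForce N (d := d) (L := L) β) ε)
          (fun U => β * wilsonAction (suRep N) U) nstep) (wilsonMeasure (d := d) (L := L) (suRep N) β) g (2 * m) +
        Scoring.autocov (sunLeapfrogHMCN (sunCoordι N) (sunCoordι_skew N) ε (Measure.addHaar : Measure (SUNCoords N)) (sunKinetic N)
          (measurable_halfKick_sun N (measurable_sunWilsonForce N (d := d) (L := L) β) ε)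
          (fun U => β * wilsonAction (suRep N) U) nstep) (wilsonMeasure (d := d) (L := L) (suRep N) β) g (2 * m + 1) := by
  haveI := isMarkovKernel_sunLeapfrogHMCN_sunKinetic N (Lk := Edge d L) ε
    (measurable_halfKick_sun N (measurable_sunWilsonForce N (d := d) (L := L) β) ε)
    ((continuous_smul_wilsonAction (suRep N) continuous_suRep β).measurable) nstep
  haveI := isProbabilityMeasure_wilsonMeasure (d := d) (L := L) (suRep N) continuous_suRep β
  exact Scoring.autocov_pair_nonneg_of_isReversible (wilsonForce_sunLeapfrogHMCN_isReversible N β ε nstep) hg hB m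

/-- **THE MADRAS–SLADE FLOOR FOR THE PERIODIC ARM**: in equilibrium, for every bounded measurable observable `g` with summable
autocorrelation `ρ` and `ρ(1) < 1`: `(1 + ρ(1))/(2(1 − ρ(1))) ≤ τ_int(g)`. -/
theorem wilsonHmc_tauInt_ge [NeZero N] (β ε : ℝ) (nstep : ℕ) {g : GaugeConfig d L (Matrix.specialUnitaryGroup (Fin N) ℂ) → ℝ}
    (hg : Measurable g) {B : ℝ} (hB : ∀ U, |g U| ≤ B)
    (hs : Summable fun t => Scoring.autocov (sunLeapfrogHMCN (sunCoordι N) (sunCoordι_skew N) ε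
        (Measure.addHaar : Measure (SUNCoords N)) (sunKinetic N)
        (measurable_halfKick_sun N (measurable_sunWilsonForce N (d := d) (L := L) β) ε)
        (fun U => β * wilsonAction (suRep N) U) nstep) (wilsonMeasure (d := d) (L := L) (suRep N) β) g (t + 1) /
      Scoring.autocov (sunLeapfrogHMCN (sunCoordι N) (sunCoordι_skew N) ε (Measure.addHaar : Measure (SUNCoords N)) (sunKinetic N)
        (measurable_halfKick_sun N (measurable_sunWilsonForce N (d := d) (L := L) β) ε)
        (fun U => β * wilsonAction (suRep N) U) nstep) (wilsonMeasure (d := d) (L := L) (suRep N) β) g 0)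
    (hρ : Scoring.autocov (sunLeapfrogHMCN (sunCoordι N) (sunCoordι_skew N) ε (Measure.addHaar : Measure (SUNCoords N))
        (sunKinetic N) (measurable_halfKick_sun N (measurable_sunWilsonForce N (d := d) (L := L) β) ε)
        (fun U => β * wilsonAction (suRep N) U) nstep) (wilsonMeasure (d := d) (L := L) (suRep N) β) g 1 /
      Scoring.autocov (sunLeapfrogHMCN (sunCoordι N) (sunCoordι_skew N) ε (Measure.addHaar : Measure (SUNCoords N))
        (sunKinetic N) (measurable_halfKick_sun N (measurable_sunWilsonForce N (d := d) (L := L) β) ε)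
        (fun U => β * wilsonAction (suRep N) U) nstep) (wilsonMeasure (d := d) (L := L) (suRep N) β) g 0 < 1) :
    (1 + Scoring.autocov (sunLeapfrogHMCN (sunCoordι N) (sunCoordι_skew N) ε (Measure.addHaar : Measure (SUNCoords N))
          (sunKinetic N) (measurable_halfKick_sun N (measurable_sunWilsonForce N (d := d) (L := L) β) ε)
          (fun U => β * wilsonAction (suRep N) U) nstep) (wilsonMeasure (d := d) (L := L) (suRep N) β) g 1 /
        Scoring.autocov (sunLeapfrogHMCN (sunCoordι N) (sunCoordι_skew N) ε (Measure.addHaar : Measure (SUNCoords N))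
          (sunKinetic N) (measurable_halfKick_sun N (measurable_sunWilsonForce N (d := d) (L := L) β) ε)
          (fun U => β * wilsonAction (suRep N) U) nstep) (wilsonMeasure (d := d) (L := L) (suRep N) β) g 0) /
      (2 * (1 - Scoring.autocov (sunLeapfrogHMCN (sunCoordι N) (sunCoordι_skew N) ε (Measure.addHaar : Measure (SUNCoords N))
          (sunKinetic N) (measurable_halfKick_sun N (measurable_sunWilsonForce N (d := d) (L := L) β) ε)
          (fun U => β * wilsonAction (suRep N) U) nstep) (wilsonMeasure (d := d) (L := L) (suRep N) β) g 1 /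
        Scoring.autocov (sunLeapfrogHMCN (sunCoordι N) (sunCoordι_skew N) ε (Measure.addHaar : Measure (SUNCoords N))
          (sunKinetic N) (measurable_halfKick_sun N (measurable_sunWilsonForce N (d := d) (L := L) β) ε)
          (fun U => β * wilsonAction (suRep N) U) nstep) (wilsonMeasure (d := d) (L := L) (suRep N) β) g 0)) ≤
      Scoring.tauInt fun t => Scoring.autocov (sunLeapfrogHMCN (sunCoordι N) (sunCoordι_skew N) ε
          (Measure.addHaar : Measure (SUNCoords N)) (sunKinetic N)
          (measurable_halfKick_sun N (measurable_sunWilsonForce N (d := d) (L := L) β) ε)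
          (fun U => β * wilsonAction (suRep N) U) nstep) (wilsonMeasure (d := d) (L := L) (suRep N) β) g t /
        Scoring.autocov (sunLeapfrogHMCN (sunCoordι N) (sunCoordι_skew N) ε (Measure.addHaar : Measure (SUNCoords N))
          (sunKinetic N) (measurable_halfKick_sun N (measurable_sunWilsonForce N (d := d) (L := L) β) ε)
          (fun U => β * wilsonAction (suRep N) U) nstep) (wilsonMeasure (d := d) (L := L) (suRep N) β) g 0 := by
  haveI := isMarkovKernel_sunLeapfrogHMCN_sunKinetic N (Lk := Edge d L) ε
    (measurable_halfKick_sun N (measurable_sunWilsonForce N (d := d) (L := L) β) ε)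
    ((continuous_smul_wilsonAction (suRep N) continuous_suRep β).measurable) nstep
  haveI := isProbabilityMeasure_wilsonMeasure (d := d) (L := L) (suRep N) continuous_suRep β
  exact Scoring.tauInt_ge_of_isReversible (wilsonForce_sunLeapfrogHMCN_isReversible N β ε nstep) hg hB hs hρ

/-- **Even-lag autocovariances of the open-boundary arm in equilibrium are nonnegative.** -/
theorem obcHmc_autocov_even_nonneg [NeZero N] (τ : Fin d) (β ε : ℝ) (nstep : ℕ)
    {g : GaugeConfig d L (Matrix.specialUnitaryGroup (Fin N) ℂ) → ℝ} (hg : Measurable g) {B : ℝ} (hB : ∀ U, |g U| ≤ B) (m : ℕ) :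
    0 ≤ Scoring.autocov (sunLeapfrogHMCN (sunCoordι N) (sunCoordι_skew N) ε (Measure.addHaar : Measure (SUNCoords N)) (sunKinetic N)
        (measurable_halfKick_sun N (measurable_sunWeightedForce N (d := d) (L := L) (obcWeight τ) β) ε)
        (fun U => β * obcAction (suRep N) τ U) nstep)
      (gibbsProbability (Measure.pi fun _ : Edge d L => haarProbability (Matrix.specialUnitaryGroup (Fin N) ℂ))
        fun U => Real.exp (-(β * obcAction (suRep N) τ U))) g (2 * m) := by
  haveI := isMarkovKernel_sunLeapfrogHMCN_sunKinetic N (Lk := Edge d L) ε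
    (measurable_halfKick_sun N (measurable_sunWeightedForce N (d := d) (L := L) (obcWeight τ) β) ε)
    ((continuous_obcAction (suRep N) continuous_suRep τ).measurable.const_mul β) nstep
  haveI := isProbabilityMeasure_obcGibbs (d := d) (L := L) (suRep N) continuous_suRep τ β
  exact Scoring.autocov_even_nonneg_of_isReversible (obcForce_sunLeapfrogHMCN_isReversible N τ β ε nstep) hg hB m

/-- **Pair positivity for the open-boundary arm**: `C_g(2m) + C_g(2m+1) ≥ 0`. -/
theorem obcHmc_autocov_pair_nonneg [NeZero N] (τ : Fin d) (β ε : ℝ) (nstep : ℕ)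
    {g : GaugeConfig d L (Matrix.specialUnitaryGroup (Fin N) ℂ) → ℝ} (hg : Measurable g) {B : ℝ} (hB : ∀ U, |g U| ≤ B) (m : ℕ) :
    0 ≤ Scoring.autocov (sunLeapfrogHMCN (sunCoordι N) (sunCoordι_skew N) ε (Measure.addHaar : Measure (SUNCoords N)) (sunKinetic N)
          (measurable_halfKick_sun N (measurable_sunWeightedForce N (d := d) (L := L) (obcWeight τ) β) ε)
          (fun U => β * obcAction (suRep N) τ U) nstep)
        (gibbsProbability (Measure.pi fun _ : Edge d L => haarProbability (Matrix.specialUnitaryGroup (Fin N) ℂ))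
          fun U => Real.exp (-(β * obcAction (suRep N) τ U))) g (2 * m) +
      Scoring.autocov (sunLeapfrogHMCN (sunCoordι N) (sunCoordι_skew N) ε (Measure.addHaar : Measure (SUNCoords N)) (sunKinetic N)
          (measurable_halfKick_sun N (measurable_sunWeightedForce N (d := d) (L := L) (obcWeight τ) β) ε)
          (fun U => β * obcAction (suRep N) τ U) nstep)
        (gibbsProbability (Measure.pi fun _ : Edge d L => haarProbability (Matrix.specialUnitaryGroup (Fin N) ℂ))
          fun U => Real.exp (-(β * obcAction (suRep N) τ U))) g (2 * m + 1) := by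
  haveI := isMarkovKernel_sunLeapfrogHMCN_sunKinetic N (Lk := Edge d L) ε
    (measurable_halfKick_sun N (measurable_sunWeightedForce N (d := d) (L := L) (obcWeight τ) β) ε)
    ((continuous_obcAction (suRep N) continuous_suRep τ).measurable.const_mul β) nstep
  haveI := isProbabilityMeasure_obcGibbs (d := d) (L := L) (suRep N) continuous_suRep τ β
  exact Scoring.autocov_pair_nonneg_of_isReversible (obcForce_sunLeapfrogHMCN_isReversible N τ β ε nstep) hg hB m

end Floors

end Summit.Ventures.LatticeQCDFlow.Exactness
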